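import Literature.NumberTheory.LFunctions.ChebyshevHalfLineBiasImprimitiveRiesz
import Literature.NumberTheory.LFunctions.ChebyshevHalfLineBiasThm1Proofs
import Literature.NumberTheory.LFunctions.ChebyshevHalfLineBiasThm7Proofs
import Literature.NumberTheory.LFunctions.ChebyshevHalfLineBiasCharacters
import Literature.NumberTheory.LFunctions.ZetaRealAxis
import HarnessLib

/-!
# GRH-CONDITIONAL limit inside a GRH-EQUIVALENT criterion (Suzuki 2025, Thm 6 (ii), (1.23) «if»), PROVED — «nothing here bears on the truth of RH»
# `lim_{x→∞} [Σ_{n ≤ x, n ≡ 1 (q)} Λ(n) n^{-1/2}(1 − log n/log x) − 4√x/(φ(q) log x)] = −φ(q)^{-1} Σ_χ (L'/L)(½, χ)` under GRH for all `χ` mod `q`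

LINE 1 — LABEL: GRH-CONDITIONAL limit (the «if» half of Thm 6 (ii)), PROVED by summing the tree's per-character
asymptotics over the characters mod `q`: the non-principal ones by `ChebyshevHalfLineBiasImprimitiveRiesz.lean`
(`tendsto`/`exists_norm_halfLineSum_add_le_of_GRH'`, every `χ ≠ χ₀`), the principal one by the tree's RH-conditional
`ζ` asymptotic (`ChebyshevHalfLineBiasThm1Proofs.lean`, Suzuki (1.7)/(1.9)) moved from `ζ` to `L(s, χ₀) = ζ(s)Π_{p∣q}(1 − p^{-s})`.
bears_on: LADDER-RH COLUMN 1 SCREW (S-C, criterion rung: Suzuki's Thm 6 (ii), typed as the first clause of the named fact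
`Suzuki2025Chebyshev_thm6_limits`; only its direction GRH ⟹ (1.23) is proved here). WHAT THIS IS NOT: not a route, not
progress toward RH or GRH — under GRH it computes a limit; nothing here bears on the truth of RH.

M. Suzuki, *On variants of Chebyshev's conjecture*, Ramanujan J. **68** (2025), no. 4, art. 95 = arXiv:2411.07436
[`Suzuki2025Chebyshev`; PUBLISHED, refereed], §1.3 **Theorem 6 (ii)**, AS PRINTED: «Suppose that `L(1/2, χ) ≠ 0` for all
Dirichlet character `χ` modulo `q`. Then, we have
`lim_{x→∞} [Σ_{n ≤ x, n ≡ 1 mod q} Λ(n) n^{-1/2}(1 − log n/log x) − 4√x/(φ(q) log x)] = −φ(q)^{-1} Σ_{χ mod q} (L'/L)(1/2, χ)`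
(1.23) if and only if the GRH for `L(s, χ)` holds for all Dirichlet characters `χ` modulo `q`.» Printed proof (§5.1):
«By the orthogonality of Dirichlet characters, `Σ_{n ≤ x, n ≡ 1 (q)} Λ(n) n^{-1/2} log(x/n) = φ(q)^{-1} Σ_χ g_χ(x)` (5.1) …
(5.7) [the explicit formula of each `g_χ`, the principal character contributing the term `4√x` from the pole of
`(L'/L)(s, χ₀)` at `s = 1`]». This file:

* §1 `logDeriv_LFunction_changeLevel`: `(L'/L)(½, χ^{(N)}) = (L'/L)(½, ψ) + Σ_{p ∣ N} log p · r_p/(1 − r_p)` for ANY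
  `ψ` mod `M ∣ N` with `L(½, ψ) ≠ 0` (the identity `L(s, χ^{(N)}) = L(s, ψ)Π_{p∣N}(1 − ψ(p)p^{-s})`, Mathlib
  `LFunction_changeLevel`, holds for `s ≠ 1`, an open neighbourhood of `½`), and `halfLineSum_changeLevel`:
  `f_{χ^{(N)}} = f_ψ − (prime powers p^k, p ∣ N)`;
* §2 `exists_norm_halfLineSum_one_le_of_RH`: **RH ⟹ `‖f_{χ₀}(x) − 4√x + (L'/L)(½, χ₀) log x‖ ≤ B`** for the principal
  character `χ₀` mod `q` — from the tree's `ChebyshevHalfLineBiasThm1.key_identity` / `numerator_abs_le` (the `ζ` case,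
  `χ₀` mod `1`, with `(ζ'/ζ)(½) = ½(γ + π/2 + 3 log 2 + log π)`, `logDeriv_riemannZeta_one_half`) and the `p ∣ q` correction of
  `ChebyshevHalfLineBiasImprimitiveRiesz.lean` (`sum_not_coprime_eq`, `norm_inner_sub_le`);
* §3 `tendsto_progressionRieszMean_of_GRH`: **GRH for all `χ` mod `q` and `L(½, χ) ≠ 0` for all `χ` ⟹ (1.23)**, with the
  left- and right-hand sides exactly as typed in the first clause of `Suzuki2025Chebyshev_thm6_limits` (orthogonality:
  the tree's `ChebyshevHalfLineBiasThm7.charHalfLineBiasSum_eq`).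

Not proved here: the converse (1.23) ⟹ GRH, and clauses (iii)–(v) of Thm 6. GRH-CONDITIONAL clause of a
GRH-EQUIVALENT criterion; nothing in this file is, or is worded as, progress toward RH or GRH. Theorems only
(D-0014/D-0026): no named facts, no definitions.

## References
* [Suzuki2025Chebyshev] M. Suzuki, Ramanujan J. 68 (2025) 95 = arXiv:2411.07436: §1.3 Thm 6 (ii) (1.23); §5.1 (5.1),
  (5.7); §1.1 (1.7), (1.9) (the `ζ` case).
* [DavenportMNT1980] H. Davenport, *Multiplicative Number Theory*, 2nd ed., ch. 5 (2)–(3) (`L(s, χ) = L(s, χ*)Π(1 − χ*(p)p^{-s})`).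
-/

noncomputable section

open Filter Topology Set ArithmeticFunction
open scoped Real

namespace Literature.NumberTheory.LFunctions

namespace ProgressionsRiesz

open HalfLineRiesz HalfLineRieszImprimitive

/-! ## §1 Change of level: `f` and `(L'/L)(½)` for `χ^{(N)} = changeLevel ψ` -/

/-- At `n` coprime to `N`, `χ^{(N)}(n) = ψ(n)`; otherwise `χ^{(N)}(n) = 0`. [folklore] -/
private theorem changeLevel_natCast_eq {M N : ℕ} (h : M ∣ N) (ψ : DirichletCharacter ℂ M) (n : ℕ) :
    DirichletCharacter.changeLevel h ψ (n : ZMod N) = if n.Coprime N then ψ (n : ZMod M) else 0 := by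
  by_cases hn : n.Coprime N
  · rw [if_pos hn]
    obtain ⟨u, hu⟩ := (ZMod.isUnit_iff_coprime n N).2 hn
    rw [← hu, DirichletCharacter.changeLevel_eq_cast_of_dvd, hu, ZMod.cast_natCast h]
  · rw [if_neg hn]
    exact MulChar.map_nonunit _ ((ZMod.isUnit_iff_coprime n N).not.2 hn)

/-- **`f_{χ^{(N)}}(x) = f_ψ(x) − Σ_{n ≤ x, (n, N) > 1} Λ(n)ψ(n) n^{-1/2} log(x/n)`**. [cite: Suzuki2025Chebyshev, §5.1 (5.7)] -/
theorem halfLineSum_changeLevel {M N : ℕ} (h : M ∣ N) (ψ : DirichletCharacter ℂ M) (x : ℝ) :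
    halfLineSum (DirichletCharacter.changeLevel h ψ) x = halfLineSum ψ x -
      ∑ n ∈ (Finset.Icc 1 ⌊x⌋₊).filter (fun n ↦ ¬ n.Coprime N),
        (Λ n : ℂ) * ψ n / (Real.sqrt n : ℂ) * (Real.log (x / n) : ℂ) := by
  rw [halfLineSum, halfLineSum, eq_sub_iff_add_eq]
  conv_rhs => rw [← Finset.sum_filter_add_sum_filter_not (Finset.Icc 1 ⌊x⌋₊) (fun n ↦ n.Coprime N)]
  congr 1
  rw [Finset.sum_filter]
  refine Finset.sum_congr rfl fun n _ ↦ ?_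
  rw [changeLevel_natCast_eq h ψ n]
  split_ifs with hc
  · rfl
  · simp

/-- `p^{-1/2} = 1/√p` in `ℂ`. [folklore] -/
private theorem natCast_cpow_neg_half (p : ℕ) :
    (p : ℂ) ^ (-(1 / 2 : ℂ)) = (((Real.sqrt p)⁻¹ : ℝ) : ℂ) := by
  have hp0 : (0 : ℝ) ≤ p := Nat.cast_nonneg _
  rw [show (-(1 / 2 : ℂ)) = ((-(1 / 2) : ℝ) : ℂ) by push_cast; ring, ← Complex.ofReal_natCast,
    ← Complex.ofReal_cpow hp0, Real.rpow_neg hp0, ← Real.sqrt_eq_rpow]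

/-- The Euler factor at `½` is `1 − r_p`, and it is non-zero. [folklore] -/
private theorem eulerFactor_half {M : ℕ} (ψ : DirichletCharacter ℂ M) {p : ℕ} (hp : p.Prime) :
    1 - ψ p * (p : ℂ) ^ (-(1 / 2 : ℂ)) = 1 - eulerRatio ψ p ∧ 1 - eulerRatio ψ p ≠ 0 := by
  have heq : 1 - ψ p * (p : ℂ) ^ (-(1 / 2 : ℂ)) = 1 - eulerRatio ψ p := by
    rw [natCast_cpow_neg_half p, eulerRatio, Complex.ofReal_inv, div_eq_mul_inv]
  refine ⟨heq, fun h0 ↦ ?_⟩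
  have hsp : 0 < Real.sqrt p := Real.sqrt_pos.2 (by exact_mod_cast hp.pos)
  have h1 : ‖eulerRatio ψ p‖ = 1 := by rw [← sub_eq_zero.1 h0, norm_one]
  have h2 : ‖eulerRatio ψ p‖ < 1 := by
    rw [eulerRatio, norm_div, Complex.norm_real, Real.norm_eq_abs, abs_of_pos hsp]
    have hs1 : 1 < Real.sqrt p := by
      rw [← Real.sqrt_one]
      exact Real.sqrt_lt_sqrt (by norm_num) (by exact_mod_cast hp.one_lt)
    calc ‖ψ p‖ / Real.sqrt p ≤ 1 / Real.sqrt p := div_le_div_of_nonneg_right (ψ.norm_le_one _) hsp.le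
      _ < 1 := (div_lt_one hsp).2 hs1
  rw [h1] at h2
  exact lt_irrefl _ h2

/-- The Euler factor `s ↦ 1 − ψ(p)p^{-s}` is differentiable. [folklore] -/
private theorem differentiableAt_eulerFactor {M : ℕ} (ψ : DirichletCharacter ℂ M) {p : ℕ} (hp : p.Prime) (s : ℂ) :
    DifferentiableAt ℂ (fun s : ℂ ↦ 1 - ψ p * (p : ℂ) ^ (-s)) s := by
  have hp0 : (p : ℂ) ≠ 0 := by exact_mod_cast hp.ne_zero
  exact ((differentiableAt_id.neg.const_cpow (Or.inl hp0)).const_mul _).const_sub _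

/-- **`(L'/L)(½, χ^{(N)}) = (L'/L)(½, ψ) + Σ_{p ∣ N} log p · r_p/(1 − r_p)`** for every `ψ` mod `M ∣ N` (principal
allowed) with `L(½, ψ) ≠ 0`; `r_p = ψ(p)/√p`. The level-change identity holds on the open set `s ≠ 1 ∋ ½`.
[cite: DavenportMNT1980, ch. 5 (2)–(3)] -/
theorem logDeriv_LFunction_changeLevel {M N : ℕ} [NeZero M] [NeZero N] (h : M ∣ N) (ψ : DirichletCharacter ℂ M)
    (hhalf : ψ.LFunction (1 / 2) ≠ 0) :
    logDeriv (DirichletCharacter.changeLevel h ψ).LFunction (1 / 2) = logDeriv ψ.LFunction (1 / 2) +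
      ∑ p ∈ N.primeFactors, Real.log p * eulerRatio ψ p / (1 - eulerRatio ψ p) := by
  have h12 : (1 / 2 : ℂ) ≠ 1 := by norm_num
  set G : ℂ → ℂ := fun s ↦ ψ.LFunction s * ∏ p ∈ N.primeFactors, (1 - ψ p * (p : ℂ) ^ (-s)) with hG
  have hEq : (DirichletCharacter.changeLevel h ψ).LFunction =ᶠ[𝓝 (1 / 2 : ℂ)] G :=
    Filter.eventuallyEq_of_mem (isOpen_ne.mem_nhds h12) fun s hs ↦
      DirichletCharacter.LFunction_changeLevel h ψ (Or.inr hs)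
  have hval : (DirichletCharacter.changeLevel h ψ).LFunction (1 / 2) = G (1 / 2) :=
    DirichletCharacter.LFunction_changeLevel h ψ (Or.inr h12)
  have hfac : ∀ p ∈ N.primeFactors, (1 - ψ p * (p : ℂ) ^ (-(1 / 2 : ℂ))) ≠ 0 := fun p hp ↦ by
    rw [(eulerFactor_half ψ (Nat.prime_of_mem_primeFactors hp)).1]
    exact (eulerFactor_half ψ (Nat.prime_of_mem_primeFactors hp)).2
  have hdfac : ∀ p ∈ N.primeFactors, DifferentiableAt ℂ (fun s : ℂ ↦ 1 - ψ p * (p : ℂ) ^ (-s)) (1 / 2) :=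
    fun p hp ↦ differentiableAt_eulerFactor ψ (Nat.prime_of_mem_primeFactors hp) _
  rw [logDeriv_apply, logDeriv_apply, hEq.deriv_eq, hval]
  have hG' : deriv G (1 / 2) / G (1 / 2) = logDeriv G (1 / 2) := (logDeriv_apply G _).symm
  rw [hG', hG, logDeriv_mul (g := fun s : ℂ ↦ ∏ p ∈ N.primeFactors, (1 - ψ p * (p : ℂ) ^ (-s))) (1 / 2) hhalf
    (Finset.prod_ne_zero_iff.2 hfac) (ψ.differentiableAt_LFunction _ (Or.inl h12))
    (DifferentiableAt.fun_finsetProd hdfac), logDeriv_prod hfac hdfac, logDeriv_apply]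
  congr 1
  exact Finset.sum_congr rfl fun p hp ↦ logDeriv_eulerFactor ψ (Nat.prime_of_mem_primeFactors hp)

/-! ## §2 The principal character: `f_{χ₀}(x) = 4√x − (L'/L)(½, χ₀) log x + O(1)` under RH -/

/-- The trivial character mod `1` takes the value `1` everywhere. [folklore] -/
private theorem one_modOne_apply (a : ZMod 1) : (1 : DirichletCharacter ℂ 1) a = 1 :=
  MulChar.one_apply (isUnit_of_subsingleton _)

/-- `f_ζ(x)` (the character mod `1`) is `log x` times the real Riesz mean of Suzuki's (1.9). [folklore] -/
private theorem halfLineSum_modOne_eq {x : ℝ} (hx : 1 < x) :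
    halfLineSum (1 : DirichletCharacter ℂ 1) x =
      (Real.log x : ℂ) * ((∑ n ∈ Finset.Icc 1 ⌊x⌋₊, Λ n / Real.sqrt n * (1 - Real.log n / Real.log x) : ℝ) : ℂ) := by
  have hlx : (Real.log x : ℂ) ≠ 0 := by exact_mod_cast (Real.log_pos hx).ne'
  have h := rieszMean_eq_halfLineSum_div (1 : DirichletCharacter ℂ 1) hx
  rw [eq_div_iff hlx] at h
  rw [← h, mul_comm, Complex.ofReal_sum]
  congr 1
  refine Finset.sum_congr rfl fun n _ ↦ ?_
  rw [one_modOne_apply]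
  push_cast
  ring

/-- **RH ⟹ `|f_ζ(x) − 4√x + (ζ'/ζ)(½) log x| ≤ K`** (`x > 1`), the `ζ` case in the shape used below: from the tree's
(1.7)/(1.9) identity `ChebyshevHalfLineBiasThm1.key_identity`, its bound `numerator_abs_le` under «`Ψ` bounded ⟺ RH»
(`ZetaScrewGrowth.riemannHypothesis_iff_zetaScrew_bounded`), and `(ζ'/ζ)(½) = ½(γ + π/2 + 3 log 2 + log π)`
(`logDeriv_riemannZeta_one_half`). RH-CONDITIONAL. [cite: Suzuki2025Chebyshev, §1.1 (1.7) and (1.9)] -/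
theorem exists_norm_halfLineSum_modOne_le_of_RH (hRH : RiemannHypothesis) :
    ∃ K : ℝ, ∀ x : ℝ, 1 < x →
      ‖halfLineSum (1 : DirichletCharacter ℂ 1) x - 4 * Real.sqrt x +
          (Real.log x : ℂ) * logDeriv riemannZeta (1 / 2)‖ ≤ K := by
  obtain ⟨M, hM⟩ := ZetaScrewGrowth.riemannHypothesis_iff_zetaScrew_bounded.1 hRH
  refine ⟨12 + M + (∑' k : ℕ, 1 / ((k : ℝ) + 1 / 4) ^ 2) / 4, fun x hx ↦ ?_⟩
  have hlx : 0 < Real.log x := Real.log_pos hx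
  have hkey := ChebyshevHalfLineBiasThm1.key_identity hx
  have hnum := ChebyshevHalfLineBiasThm1.numerator_abs_le hM hx
  set R : ℝ := ∑ n ∈ Finset.Icc 1 ⌊x⌋₊, Λ n / Real.sqrt n * (1 - Real.log n / Real.log x) with hR
  set κ : ℝ := (Real.eulerMascheroniConstant + Real.pi / 2 + 3 * Real.log 2 + Real.log Real.pi) / 2 with hκ
  set Nu : ℝ := 4 / Real.sqrt x - 8 - zetaScrew (Real.log x)
      + (1 / 4) * ((∑' k : ℕ, 1 / ((k : ℝ) + 1 / 4) ^ 2)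
          - Real.exp (-(Real.log x / 2)) * hurwitzLerchQuarter (Real.log x)) with hNu
  have hlxR : Real.log x ≠ 0 := hlx.ne'
  have hreal : halfLineSum (1 : DirichletCharacter ℂ 1) x - 4 * Real.sqrt x +
      (Real.log x : ℂ) * logDeriv riemannZeta (1 / 2) = ((Real.log x * (R - 4 * Real.sqrt x / Real.log x + κ) : ℝ) : ℂ) := by
    rw [halfLineSum_modOne_eq hx, logDeriv_riemannZeta_one_half, ← hR, ← hκ,
      show Real.log x * (R - 4 * Real.sqrt x / Real.log x + κ) = Real.log x * R - 4 * Real.sqrt x + Real.log x * κ by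
        field_simp]
    push_cast
    ring
  rw [hreal, Complex.norm_real, Real.norm_eq_abs, hkey, mul_div_cancel₀ _ hlx.ne']
  exact hnum

/-- `L(s, χ₀) = 0` in the open strip forces `ζ(s) = 0` there; hence GRH for the principal character mod `q` gives RH.
[folklore] -/
private theorem riemannHypothesis_of_principal {q : ℕ} [NeZero q]
    (h : (1 : DirichletCharacter ℂ q).RiemannHypothesis) : RiemannHypothesis := by
  refine riemannHypothesis_iff_strip_holds.2 fun s hs h0 h1 ↦ h s ?_ h0 h1
  have hs1 : s ≠ 1 := fun h ↦ by rw [h, Complex.one_re] at h1; exact lt_irrefl _ h1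
  have key := DirichletCharacter.LFunction_changeLevel (one_dvd q) (1 : DirichletCharacter ℂ 1) (s := s) (Or.inr hs1)
  rw [DirichletCharacter.changeLevel_one, DirichletCharacter.LFunction_modOne_eq, hs, zero_mul] at key
  exact key

/-- `ζ(½) ≠ 0`, as the `L`-function of the character mod `1`. [folklore] -/
private theorem LFunction_modOne_half_ne_zero : (1 : DirichletCharacter ℂ 1).LFunction (1 / 2) ≠ 0 := by
  rw [DirichletCharacter.LFunction_modOne_eq]
  have := riemannZeta_ofReal_ne_zero_of_pos_of_lt_one (1 / 2) (by norm_num) (by norm_num)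
  push_cast at this
  exact this

/-- **RH ⟹ `‖f_{χ₀}(x) − 4√x + (L'/L)(½, χ₀) log x‖ ≤ B`** (`x > 1`) for the principal character `χ₀` mod `q`: the `ζ` case
plus the prime powers `p^k`, `p ∣ q` (which shift the coefficient of `log x` by `(L'/L)(½, χ₀) − (ζ'/ζ)(½)` and the
constant by `O(1)`). RH-CONDITIONAL. [cite: Suzuki2025Chebyshev, §5.1 (5.7)] -/
theorem exists_norm_halfLineSum_one_le_of_RH {q : ℕ} [NeZero q] (hRH : RiemannHypothesis) :
    ∃ B : ℝ, ∀ x : ℝ, 1 < x →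
      ‖halfLineSum (1 : DirichletCharacter ℂ q) x - 4 * Real.sqrt x +
          (Real.log x : ℂ) * logDeriv (1 : DirichletCharacter ℂ q).LFunction (1 / 2)‖ ≤ B := by
  obtain ⟨K, hK⟩ := exists_norm_halfLineSum_modOne_le_of_RH hRH
  set ψ : DirichletCharacter ℂ 1 := 1 with hψ
  set C : ℝ := ∑ p ∈ q.primeFactors, (8 * Real.log p + 12 * Real.log p ^ 2) with hC
  refine ⟨K + C, fun x hx ↦ ?_⟩
  have hx0 : 0 < x := by linarith
  have h1q : (1 : DirichletCharacter ℂ q) = DirichletCharacter.changeLevel (one_dvd q) ψ := by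
    rw [hψ, DirichletCharacter.changeLevel_one]
  have hlogd : logDeriv (1 : DirichletCharacter ℂ q).LFunction (1 / 2) = logDeriv riemannZeta (1 / 2) +
      ∑ p ∈ q.primeFactors, Real.log p * eulerRatio ψ p / (1 - eulerRatio ψ p) := by
    rw [h1q, logDeriv_LFunction_changeLevel (one_dvd q) ψ LFunction_modOne_half_ne_zero,
      DirichletCharacter.LFunction_modOne_eq]
  have hsplit : halfLineSum (1 : DirichletCharacter ℂ q) x - 4 * Real.sqrt x +
      (Real.log x : ℂ) * logDeriv (1 : DirichletCharacter ℂ q).LFunction (1 / 2) =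
      (halfLineSum ψ x - 4 * Real.sqrt x + (Real.log x : ℂ) * logDeriv riemannZeta (1 / 2)) -
        ∑ p ∈ q.primeFactors,
          (∑ k ∈ Finset.Icc 1 (Nat.log p ⌊x⌋₊),
              (Real.log p : ℂ) * eulerRatio ψ p ^ k * ((Real.log x - k * Real.log p : ℝ) : ℂ) -
            (Real.log x : ℂ) * (Real.log p * eulerRatio ψ p / (1 - eulerRatio ψ p))) := by
    rw [hlogd, h1q, halfLineSum_changeLevel (one_dvd q) ψ x, sum_not_coprime_eq ψ hx0, mul_add, Finset.mul_sum,
      Finset.sum_sub_distrib]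
    ring
  rw [hsplit]
  calc ‖(halfLineSum ψ x - 4 * Real.sqrt x + (Real.log x : ℂ) * logDeriv riemannZeta (1 / 2)) -
        ∑ p ∈ q.primeFactors,
          (∑ k ∈ Finset.Icc 1 (Nat.log p ⌊x⌋₊),
              (Real.log p : ℂ) * eulerRatio ψ p ^ k * ((Real.log x - k * Real.log p : ℝ) : ℂ) -
            (Real.log x : ℂ) * (Real.log p * eulerRatio ψ p / (1 - eulerRatio ψ p)))‖
      ≤ ‖halfLineSum ψ x - 4 * Real.sqrt x + (Real.log x : ℂ) * logDeriv riemannZeta (1 / 2)‖ +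
        ‖∑ p ∈ q.primeFactors,
          (∑ k ∈ Finset.Icc 1 (Nat.log p ⌊x⌋₊),
              (Real.log p : ℂ) * eulerRatio ψ p ^ k * ((Real.log x - k * Real.log p : ℝ) : ℂ) -
            (Real.log x : ℂ) * (Real.log p * eulerRatio ψ p / (1 - eulerRatio ψ p)))‖ := norm_sub_le _ _
    _ ≤ K + C := by
        gcongr
        · exact hK x hx
        · rw [hC]
          exact le_trans (norm_sum_le _ _) (Finset.sum_le_sum fun p hp ↦
            norm_inner_sub_le ψ (Nat.prime_of_mem_primeFactors hp) hx.le)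

/-! ## §3 Orthogonality and the limit (1.23) under GRH -/

variable {q : ℕ} [NeZero q]

/-- Orthogonality for the half-line Riesz sums: for `x > 1`,
`Σ_{n ≤ x, n ≡ 1 (q)} Λ(n) n^{-1/2}(1 − log n/log x) = (φ(q) log x)^{-1} Σ_χ f_χ(x)` (Suzuki (5.1)).
[cite: Suzuki2025Chebyshev, §5.1 (5.1)] -/
theorem progressionRieszMean_eq {x : ℝ} (hx : 1 < x) :
    ((∑ n ∈ (Finset.Icc 1 ⌊x⌋₊).filter (fun n : ℕ ↦ (n : ZMod q) = 1),
        Λ n / Real.sqrt n * (1 - Real.log n / Real.log x) : ℝ) : ℂ) =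
      (∑ χ : DirichletCharacter ℂ q, halfLineSum χ x) / ((q.totient : ℂ) * (Real.log x : ℂ)) := by
  have hx0 : 0 < x := by linarith
  have hlx : (Real.log x : ℂ) ≠ 0 := by exact_mod_cast (Real.log_pos hx).ne'
  have hφ : (q.totient : ℂ) ≠ 0 := by exact_mod_cast (Nat.totient_pos.2 (NeZero.pos q)).ne'
  have horth : ∑ χ : DirichletCharacter ℂ q, halfLineSum χ x =
      (q.totient : ℂ) * ∑ n ∈ (Finset.Icc 1 ⌊x⌋₊).filter (fun n : ℕ ↦ (n : ZMod q) = 1),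
        (Λ n : ℂ) / (Real.sqrt n : ℂ) * (Real.log (x / n) : ℂ) := by
    have h := ChebyshevHalfLineBiasThm7.charHalfLineBiasSum_eq q x x
    unfold charHalfLineBiasSum at h
    simp only [halfLineSum]
    rw [h, Finset.mul_sum, Finset.sum_filter]
    refine Finset.sum_congr rfl fun n _ ↦ ?_
    split_ifs <;> simp
  rw [horth, eq_div_iff (mul_ne_zero hφ hlx), Complex.ofReal_sum, Finset.sum_mul, Finset.mul_sum]
  refine Finset.sum_congr rfl fun n hn ↦ ?_
  have hn1 : 1 ≤ n := (Finset.mem_Icc.1 (Finset.mem_filter.1 hn).1).1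
  have hn0 : (0 : ℝ) < n := by exact_mod_cast hn1
  have hlxR : Real.log x ≠ 0 := (Real.log_pos hx).ne'
  have hlog : Real.log (x / n) = Real.log x * (1 - Real.log n / Real.log x) := by
    rw [Real.log_div hx0.ne' hn0.ne', mul_sub, mul_one, mul_div_cancel₀ _ hlxR]
  rw [hlog]
  push_cast
  ring

/-- **Suzuki 2025, Thm 6 (ii), (1.23), «if» direction, PROVED**: if `L(½, χ) ≠ 0` and the GRH holds for every Dirichlet
character `χ` mod `q`, then `lim_{x→∞} [Σ_{n ≤ x, n ≡ 1 (q)} Λ(n) n^{-1/2}(1 − log n/log x) − 4√x/(φ(q) log x)] =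
−φ(q)^{-1} Σ_χ (L'/L)(½, χ)` — left- and right-hand sides as typed in the first clause of
`Suzuki2025Chebyshev_thm6_limits` (whose converse and clauses (iii)–(v) are not proved here). GRH-CONDITIONAL clause
of a GRH-EQUIVALENT criterion; nothing here bears on the truth of RH. [cite: Suzuki2025Chebyshev, §1.3 Thm 6 (ii) and §5.1 (5.7)] -/
theorem tendsto_progressionRieszMean_of_GRH (hL : ∀ χ : DirichletCharacter ℂ q, χ.LFunction (1 / 2) ≠ 0)
    (hGRH : ∀ χ : DirichletCharacter ℂ q, χ.RiemannHypothesis) :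
    Tendsto (fun x : ℝ ↦ (((∑ n ∈ (Finset.Icc 1 ⌊x⌋₊).filter (fun n : ℕ ↦ (n : ZMod q) = 1),
          Λ n / Real.sqrt n * (1 - Real.log n / Real.log x))
        - 4 * Real.sqrt x / (Nat.totient q * Real.log x) : ℝ) : ℂ)) atTop
      (𝓝 (-(1 / (Nat.totient q : ℂ)) * ∑ χ : DirichletCharacter ℂ q, logDeriv χ.LFunction (1 / 2))) := by
  have hRH : RiemannHypothesis := riemannHypothesis_of_principal (hGRH 1)
  -- per-character bounded brackets
  set g : DirichletCharacter ℂ q → ℝ → ℂ := fun χ x ↦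
    halfLineSum χ x + (Real.log x : ℂ) * logDeriv χ.LFunction (1 / 2) -
      (if χ = 1 then (4 * Real.sqrt x : ℂ) else 0) with hg
  have hbound : ∀ χ : DirichletCharacter ℂ q, ∃ B : ℝ, ∀ x : ℝ, 1 < x → ‖g χ x‖ ≤ B := by
    intro χ
    by_cases hχ : χ = 1
    · obtain ⟨B, hB⟩ := exists_norm_halfLineSum_one_le_of_RH (q := q) hRH
      refine ⟨B, fun x hx ↦ ?_⟩
      have := hB x hx
      rw [hg]
      simp only [hχ, if_true]
      rw [show halfLineSum (1 : DirichletCharacter ℂ q) x + (Real.log x : ℂ) *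
          logDeriv (1 : DirichletCharacter ℂ q).LFunction (1 / 2) - (4 * Real.sqrt x : ℂ) =
          halfLineSum (1 : DirichletCharacter ℂ q) x - 4 * Real.sqrt x +
            (Real.log x : ℂ) * logDeriv (1 : DirichletCharacter ℂ q).LFunction (1 / 2) by ring]
      exact this
    · obtain ⟨B, hB⟩ := exists_norm_halfLineSum_add_le_of_GRH' χ hχ (hL χ) (hGRH χ)
      refine ⟨B, fun x hx ↦ ?_⟩
      have := hB x hx
      rw [hg]
      simp only [hχ, if_false, sub_zero]
      rw [logDeriv_apply]
      exact this
  choose B hB using hbound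
  have hφ0 : 0 < (q.totient : ℝ) := by exact_mod_cast Nat.totient_pos.2 (NeZero.pos q)
  have hφ : (q.totient : ℂ) ≠ 0 := by exact_mod_cast hφ0.ne'
  set T : ℂ := -(1 / (Nat.totient q : ℂ)) * ∑ χ : DirichletCharacter ℂ q, logDeriv χ.LFunction (1 / 2) with hT
  rw [← tendsto_sub_nhds_zero_iff]
  have hlim : Tendsto (fun x : ℝ ↦ ((∑ χ : DirichletCharacter ℂ q, B χ) / q.totient) * (Real.log x)⁻¹)
      atTop (𝓝 0) := by
    have h := (tendsto_inv_atTop_zero.comp Real.tendsto_log_atTop).const_mul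
      ((∑ χ : DirichletCharacter ℂ q, B χ) / q.totient)
    rw [mul_zero] at h
    exact h
  refine squeeze_zero_norm' ?_ hlim
  filter_upwards [eventually_gt_atTop (1 : ℝ)] with x hx
  have hlx : 0 < Real.log x := Real.log_pos hx
  have hlxC : (Real.log x : ℂ) ≠ 0 := by exact_mod_cast hlx.ne'
  -- the difference is `(φ log x)^{-1} Σ_χ g_χ(x)`
  have hsum4 : ∑ χ : DirichletCharacter ℂ q, (if χ = 1 then (4 * Real.sqrt x : ℂ) else 0) = 4 * Real.sqrt x := by
    rw [Finset.sum_ite_eq' Finset.univ (1 : DirichletCharacter ℂ q)]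
    simp
  have hgsum : ∑ χ : DirichletCharacter ℂ q, g χ x = (∑ χ : DirichletCharacter ℂ q, halfLineSum χ x) +
      (Real.log x : ℂ) * (∑ χ : DirichletCharacter ℂ q, logDeriv χ.LFunction (1 / 2)) - 4 * Real.sqrt x := by
    simp only [hg, Finset.sum_sub_distrib, Finset.sum_add_distrib, hsum4]
    rw [← Finset.mul_sum]
  have hdiff : (((∑ n ∈ (Finset.Icc 1 ⌊x⌋₊).filter (fun n : ℕ ↦ (n : ZMod q) = 1),
          Λ n / Real.sqrt n * (1 - Real.log n / Real.log x))
        - 4 * Real.sqrt x / (Nat.totient q * Real.log x) : ℝ) : ℂ) - T =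
      (∑ χ : DirichletCharacter ℂ q, g χ x) / ((q.totient : ℂ) * (Real.log x : ℂ)) := by
    rw [hgsum, Complex.ofReal_sub, progressionRieszMean_eq hx, hT]
    push_cast
    field_simp
    ring
  rw [hdiff, norm_div, norm_mul, Complex.norm_natCast, Complex.norm_real, Real.norm_eq_abs, abs_of_pos hlx,
    div_eq_mul_inv, div_eq_mul_inv, mul_inv, ← mul_assoc]
  gcongr
  · exact le_trans (norm_sum_le _ _) (Finset.sum_le_sum fun χ _ ↦ hB χ x hx)

end ProgressionsRiesz

end Literature.NumberTheory.LFunctions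

end
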